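import Literature.AnabelianGeometry.EtaleTheta.ThetaCovers
import Mathlib.GroupTheory.SpecificGroups.Cyclic

/-!
# [EtTh] Proposition 2.2 (ii) over the BARE interface `CoverData` (proof-only companion)

Mochizuki, *The Étale Theta Function and its Frobenioid-theoretic manifestations* [EtTh], Publ. RIMS
**45** (2009), §2, Prop. 2.2 (ii), PRIMS printed p. 263 (= PDF p. 37; kurims-ms p. 34); bib key
`MochizukiEtTh2009`.

PROOF-ONLY companion (no `def`, no new named fact, nothing restated) of `ThetaCovers.lean`
(abc-iut-L2-t2, p405102). Cell abc-iut, block C / W6 row `EtTh:Prop2.2(ii)` (seat abc-iut-w6-d082),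
FACT-LIST row F-0597 `CoverData.Prop22_ii`.

State of record before this file: the named fact `CoverData.Prop22_ii` was DISCHARGED over the richer
interface `CoverDataAx` (`CoverDataAx.prop22_ii_holds`, `Discharge/Sec2DoubleCoverProofs.lean`,
abc-iut-L2-t10) and at the arithmetic model (`prop22_ii_ofSetting`), i.e. F-0597 was "model-witnessed".
Observation: the three `CoverDataAx` lemmas behind it (`Dx_sup_eigen_eq`, `Dx_inf_eigen_le`,
`splitting_sup_eigen_inf_deltaC`) use NONE of the three supplementary axioms of `CoverDataAx`
(`pow_mem_barKer`, `inv_ell`, `inv_theta`) — only the fields of `CoverData` (`aug_Dx_surjective`,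
`inertia_sup_barKer`, `barTheta_le`, `barKer_le_barTheta`, the normality of `Ker` and of the
`Δ̄_Θ`-preimage, and `IsMinusEigen.conj_mem`). Hence the UNIVERSAL CLOSURE of the fact holds:

* `CoverData.prop22_ii_holds : ∀ X : CoverData l, X.Prop22_ii` — F-0597 PROVED over the bare interface
  (every consumer `(h : X.Prop22_ii)` is dischargeable for every `X`, not only for `CoverDataAx`/models);

and, covering the printed parenthesis of (ii) "[hence `Δ_X̲̲` is a cyclic group of order `l`]" and
"`Δ̄_X̲ = Δ̄_X̲̲ · Δ̄_Θ`" by index statements not previously declared: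

* `CoverData.relIndex_barTheta_deltaX_sq` — `[Δ_X : Δ̄_Θ-preimage] = l²` (field `ell_rank_two`);
* `CoverData.relIndex_deltaXu_deltaX` — `[Δ_X : Δ_X̲] = l` (`= [Π_X : Π_X̲]`, Rmk. 2.3.1);
* `CoverData.relIndex_barTheta_deltaXu` — `[Δ_X̲ : Δ̄_Θ-preimage] = l`;
* `CoverData.relIndex_barKer_eigen` — `#Δ̄_X̲̲ = [E : Ker(Δ_X ↠ Δ̄_X)] = l` ("of order `l`");
* `CoverData.relIndex_eigen_deltaXu` — `[Δ_X̲ : E] = l` (`Δ̄_X̲/Δ̄_X̲̲ ≅ Δ̄_Θ`, "`Δ̄_X̲ = Δ̄_X̲̲ · Δ̄_Θ`");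
* `CoverData.isCyclic_eigen_quot` — for PRIME `l` (the regime of [IUTchI] Def. 3.1 (c), `l ≥ 5` prime)
  `E / Ker` is cyclic. (For composite odd `l` cyclicity also holds — `E/Ker` is the kernel of a
  surjection `(ℤ/l)² ↠ ℤ/l`, which splits — but is not needed downstream and is not typed here.)

Not covered (typing decision of record, review of p404132, docstring of `CoverData.Prop22_ii`): the last
sentence of (ii), the coset characterisation of the image of `ι̲` in `Δ_C̲/Δ_X̲̲` — as literally read every
lift normalises `Δ_X̲̲`; and the `H¹(G_K, Δ̄_Θ) ≅ K^×/(K^×)^l`-torsor structure on splittings (Kummer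
theory), which `IsSplitting` does not carry. Nothing here asserts that `CoverData` is inhabited by an
actual curve; no side is taken on [IUTchIII] Cor. 3.12; typed ≠ proved elsewhere.
-/

namespace Literature.AnabelianGeometry.EtaleTheta

namespace ThetaCovers

namespace CoverData

universe u

variable {l : ℕ} (X : CoverData.{u} l)

/-! ## The three typed conjuncts of Prop 2.2 (ii), over `CoverData` -/

/-- **Prop 2.2 (ii), surjectivity of `D_x → Π̄_X̲/Im(s_ι)`** over the bare interface: `D_x · E = Π_X̲`
(the cusp is `K`-rational: `D_x ↠ G_K`; `Δ_X̲ = E · Δ̄_Θ`-preimage and `Δ̄_Θ`-preimage `= I_x · Ker`).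
[cite: MochizukiEtTh2009, Prop 2.2(ii) p.37] -/
theorem Dx_sup_eigen_eq {H H' E : Subgroup X.PiC} {ι : X.PiC}
    (hH' : X.IsTypeLTorsPm H') (hH : H = H' ⊓ X.PiX) (hE : X.IsMinusEigen H H' ι E) :
    X.Dx ⊔ E = H := by
  have hT : X.IsTypeLTors H := by rw [hH]; exact hH'.inf_isTypeLTors
  have hEH : E ≤ H := hE.le.trans inf_le_left
  have hTle : X.barTheta ≤ X.Dx ⊔ E := by
    rw [← X.inertia_sup_barKer]
    exact sup_le (inf_le_left.trans le_sup_left) (hE.barKer_le.trans le_sup_right)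
  refine le_antisymm (sup_le hT.Dx_le hEH) fun h hh => ?_
  obtain ⟨⟨δ, hδ⟩, hδh⟩ := X.aug_Dx_surjective (X.aug h)
  have hδh : X.aug δ = X.aug h := hδh
  have hy : δ⁻¹ * h ∈ E ⊔ X.barTheta := by
    rw [hE.sup_eq]
    refine ⟨H.mul_mem (H.inv_mem (hT.Dx_le hδ)) hh, ?_⟩
    change δ⁻¹ * h ∈ X.aug.ker
    rw [MonoidHom.mem_ker, map_mul, map_inv, hδh, inv_mul_cancel]
  have hy' : δ⁻¹ * h ∈ X.Dx ⊔ E := (sup_le le_sup_right hTle) hy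
  have : h = δ * (δ⁻¹ * h) := by group
  rw [this]
  exact Subgroup.mul_mem _ (Subgroup.mem_sup_left hδ) hy'

/-- **Prop 2.2 (ii), injectivity of `D̄_x → Π̄_X̲/Im(s_ι)`** over the bare interface: `D_x ∩ E ⊆ Ker`
(`I_x` maps into the `Δ̄_Θ`-preimage, and `E ∩ Δ̄_Θ`-preimage `= Ker`).
[cite: MochizukiEtTh2009, Prop 2.2(ii) p.37] -/
theorem Dx_inf_eigen_le {H H' E : Subgroup X.PiC} {ι : X.PiC} (hE : X.IsMinusEigen H H' ι E) :
    X.Dx ⊓ E ≤ X.barKer := by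
  rintro x ⟨hxD, hxE⟩
  have hxT : x ∈ X.barTheta := by
    rw [← X.inertia_sup_barKer]
    exact Subgroup.mem_sup_left ⟨hxD, (hE.le hxE).2⟩
  rw [← hE.inf_eq]
  exact ⟨hxE, hxT⟩

/-- **Prop 2.2 (ii), "the geometric portion `Δ_X̲̲` of `Π_X̲̲ := S · E` is `Im(s_ι) = E`"** over the bare
interface: `(S · E) ∩ Δ_C = E` for every splitting `S` of `D_x ↠ G_K`.
[cite: MochizukiEtTh2009, Prop 2.2(ii) p.37] -/
theorem splitting_sup_eigen_inf_deltaC {H H' E S : Subgroup X.PiC} {ι : X.PiC}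
    (hH' : X.IsTypeLTorsPm H') (hH : H = H' ⊓ X.PiX) (hE : X.IsMinusEigen H H' ι E)
    (hS : X.IsSplitting S) : (S ⊔ E) ⊓ X.DeltaC = E := by
  haveI := X.barTheta_normal
  haveI := X.barKer_normal
  have hT : X.IsTypeLTors H := by rw [hH]; exact hH'.inf_isTypeLTors
  have hSle : S ≤ H :=
    hS.le.trans (sup_le hT.Dx_le (X.barKer_le_barTheta.trans hT.barTheta_le))
  have hEle : E ≤ H := hE.le.trans inf_le_left
  refine le_antisymm ?_ (le_inf le_sup_right (hE.le.trans inf_le_right))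
  rintro x ⟨hxSE, hxC⟩
  haveI : (E.subgroupOf H).Normal :=
    (Subgroup.normal_subgroupOf_iff hEle).mpr fun e g he hg => hE.conj_mem g hg e he
  have hx' : (⟨x, sup_le hSle hEle hxSE⟩ : H) ∈ S.subgroupOf H ⊔ E.subgroupOf H := by
    rw [← Subgroup.subgroupOf_sup hSle hEle, Subgroup.mem_subgroupOf]; exact hxSE
  obtain ⟨y, hy, z, hz, hyz⟩ := Subgroup.mem_sup_of_normal_right.mp hx'
  rw [Subgroup.mem_subgroupOf] at hy hz
  have hxyz : (y : X.PiC) * z = x := congrArg Subtype.val hyz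
  have hzC : X.aug z = 1 := (hE.le hz).2
  have hyC : X.aug y = 1 := by
    have := congrArg X.aug hxyz
    rw [map_mul, hzC, mul_one] at this
    rw [this]; exact hxC
  obtain ⟨d, hd, k, hk, hdk⟩ := Subgroup.mem_sup_of_normal_right.mp (hS.le hy)
  have hdC : X.aug d = 1 := by
    have := congrArg X.aug hdk
    rw [map_mul, (X.barTheta_le (X.barKer_le_barTheta hk)).2, mul_one, hyC] at this
    exact this
  have hyT : (y : X.PiC) ∈ X.barTheta := by
    rw [← X.inertia_sup_barKer, ← hdk]
    exact Subgroup.mul_mem _ (Subgroup.mem_sup_left ⟨hd, hdC⟩) (Subgroup.mem_sup_right hk)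
  have hyK : (y : X.PiC) ∈ X.barKer := by rw [← hS.inf_eq]; exact ⟨hy, hyT⟩
  rw [← hxyz]
  exact E.mul_mem (hE.barKer_le hyK) hz

/-- **[EtTh] Proposition 2.2 (ii) — the named fact `CoverData.Prop22_ii` (F-0597) PROVED over the bare
interface `CoverData`** (universal closure: every `X : CoverData l`): `D_x · E = Π_X̲`, `D_x ∩ E ⊆ Ker`,
`(S · E) ∩ Δ_C = E`. [cite: MochizukiEtTh2009, Prop 2.2(ii) p.37] -/
theorem prop22_ii_holds :
    Literature.AnabelianGeometry.EtaleTheta.ThetaCovers.CoverData.Prop22_ii X := by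
  intro H H' E S ι hH' hH _hι hE hS
  exact ⟨X.Dx_sup_eigen_eq hH' hH hE, X.Dx_inf_eigen_le hE,
    X.splitting_sup_eigen_inf_deltaC hH' hH hE hS⟩

/-- `Prop22_ii` — `_holds` alias of `prop22_ii_holds` above under the fact's exact name (appended
2026-08-28, D-0026 bookkeeping: the proof term is the existing theorem of this file; no statement,
definition or attribute is edited; no new named fact; the ledger's debt table listed the fact
unproved). [cite: MochizukiEtTh2009, Prop 2.2(ii) p.37] -/
theorem _root_.Literature.AnabelianGeometry.EtaleTheta.ThetaCovers.CoverData.Prop22_ii_holds :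
    Literature.AnabelianGeometry.EtaleTheta.ThetaCovers.CoverData.Prop22_ii X :=
  _root_.Literature.AnabelianGeometry.EtaleTheta.ThetaCovers.CoverData.prop22_ii_holds (X := X)

/-! ## Indices: "`Δ_X̲̲` [is a cyclic group of order `l`]", "`Δ̄_X̲ = Δ̄_X̲̲ · Δ̄_Θ`" -/

/-- `l ≠ 0` (`l` is odd). [cite: MochizukiEtTh2009, Def 2.1 p.36] -/
theorem l_ne_zero (X : CoverData.{u} l) : l ≠ 0 := by obtain ⟨k, hk⟩ := X.l_odd; omega

/-- **`[Δ_X : Δ̄_Θ-preimage] = l²`** over the BARE interface (`Δ_X/Δ̄_Θ-preimage ≅ (ℤ/l)²`, field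
`ell_rank_two`; the `CoverDataAx` form `CoverDataAx.relIndex_barTheta_deltaX` of
`Discharge/Sec2Def23OfSplitting.lean` needs the richer structure and is not applicable to a bare
`CoverData`). [cite: MochizukiEtTh2009, Def 2.1 p.35] -/
theorem relIndex_barTheta_deltaX_sq : X.barTheta.relIndex X.DeltaX = l ^ 2 := by
  haveI := X.barTheta_normal
  obtain ⟨e⟩ := X.ell_rank_two
  rw [sq, Subgroup.relIndex, Subgroup.index]
  change Nat.card (↥(X.PiX ⊓ X.aug.ker) ⧸ X.barTheta.subgroupOf (X.PiX ⊓ X.aug.ker)) = l * l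
  rw [Nat.card_congr e.toEquiv, Nat.card_congr Multiplicative.toAdd, Nat.card_prod, Nat.card_zmod]

/-- **`[Δ_X : Δ_X̲] = l`** for `Π_X̲ = H` of type `(1, l-tors)` (`Δ_X̲ = H ∩ Δ_C`; "the restricted map
`Δ̄^ell_X → Q` is still surjective", so `[Δ_X : Δ_X̲] = [Π_X : Π_X̲] = #Q = l`, Rmk. 2.3.1).
[cite: MochizukiEtTh2009, Rmk 2.3.1 p.38] -/
theorem relIndex_deltaXu_deltaX {H : Subgroup X.PiC} (hT : X.IsTypeLTors H) :
    (H ⊓ X.DeltaC).relIndex X.DeltaX = l := by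
  haveI := X.PiX_normal
  haveI : X.DeltaX.Normal := inferInstance
  have h1 : (H ⊓ X.DeltaC).relIndex X.DeltaX = H.relIndex X.DeltaX := by
    have : H ⊓ X.DeltaC ⊓ X.DeltaX = H ⊓ X.DeltaX := by
      ext x
      simp only [Subgroup.mem_inf, MonoidHom.mem_ker]
      tauto
    rw [← Subgroup.inf_relIndex_right (H ⊓ X.DeltaC) X.DeltaX, this, Subgroup.inf_relIndex_right]
  rw [h1, ← relIndex_sup_eq_relIndex_of_normal H X.DeltaX, hT.delta_sup]
  exact X.index_typeLTors H hT

/-- **`[Δ_X̲ : Δ̄_Θ-preimage] = l`** for `Π_X̲ = H` of type `(1, l-tors)` (`l·l = [Δ_X : Δ̄_Θ-preimage] =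
[Δ_X : Δ_X̲]·[Δ_X̲ : Δ̄_Θ-preimage] = l · [Δ_X̲ : Δ̄_Θ-preimage]`). [cite: MochizukiEtTh2009, Prop 2.2(i) p.37] -/
theorem relIndex_barTheta_deltaXu {H : Subgroup X.PiC} (hT : X.IsTypeLTors H) :
    X.barTheta.relIndex (H ⊓ X.DeltaC) = l := by
  have hle1 : X.barTheta ≤ H ⊓ X.DeltaC :=
    le_inf hT.barTheta_le (X.barTheta_le.trans inf_le_right)
  have hle2 : H ⊓ X.DeltaC ≤ X.DeltaX := fun x hx => ⟨hT.le hx.1, hx.2⟩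
  have h := Subgroup.relIndex_mul_relIndex X.barTheta (H ⊓ X.DeltaC) X.DeltaX hle1 hle2
  rw [X.relIndex_deltaXu_deltaX hT, X.relIndex_barTheta_deltaX_sq, sq] at h
  exact Nat.eq_of_mul_eq_mul_right (Nat.pos_of_ne_zero X.l_ne_zero) h

/-- **Prop 2.2 (ii): "`Δ_X̲̲` [is a group of order `l`]"** — `#Δ̄_X̲̲ = [E : Ker(Δ_X ↠ Δ̄_X)] = l` for the
`(−1)`-eigenspace `E = Im(s_ι)` (`E ∩ Δ̄_Θ`-preimage `= Ker`, `E · Δ̄_Θ`-preimage `= Δ_X̲`, so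
`[E : Ker] = [Δ_X̲ : Δ̄_Θ-preimage] = l`). [cite: MochizukiEtTh2009, Prop 2.2(ii) p.37] -/
theorem relIndex_barKer_eigen {H H' E : Subgroup X.PiC} {ι : X.PiC}
    (hH' : X.IsTypeLTorsPm H') (hH : H = H' ⊓ X.PiX) (hE : X.IsMinusEigen H H' ι E) :
    X.barKer.relIndex E = l := by
  haveI := X.barTheta_normal
  have hT : X.IsTypeLTors H := by rw [hH]; exact hH'.inf_isTypeLTors
  calc X.barKer.relIndex E = (X.barTheta ⊓ E).relIndex E := by rw [inf_comm, hE.inf_eq]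
    _ = X.barTheta.relIndex E := Subgroup.inf_relIndex_right _ _
    _ = X.barTheta.relIndex (E ⊔ X.barTheta) := (Subgroup.relIndex_sup_right E X.barTheta).symm
    _ = X.barTheta.relIndex (H ⊓ X.DeltaC) := by rw [hE.sup_eq]
    _ = l := X.relIndex_barTheta_deltaXu hT

/-- **Prop 2.2 (ii): "`Δ̄_X̲ = Δ̄_X̲̲ · Δ̄_Θ`", index form** — `[Δ_X̲ : E] = l` (`Δ̄_X̲/Δ̄_X̲̲ ≅ Δ̄_Θ` has order
`l`: `[E·Δ̄_Θ-preimage : E] = [Δ̄_Θ-preimage : E ∩ Δ̄_Θ-preimage] = [Δ̄_Θ-preimage : Ker] = l`).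
[cite: MochizukiEtTh2009, Prop 2.2(ii) p.37] -/
theorem relIndex_eigen_deltaXu {H H' E : Subgroup X.PiC} {ι : X.PiC}
    (hE : X.IsMinusEigen H H' ι E) : E.relIndex (H ⊓ X.DeltaC) = l := by
  haveI := X.barTheta_normal
  calc E.relIndex (H ⊓ X.DeltaC) = E.relIndex (E ⊔ X.barTheta) := by rw [hE.sup_eq]
    _ = E.relIndex X.barTheta := relIndex_sup_eq_relIndex_of_normal _ _
    _ = (E ⊓ X.barTheta).relIndex X.barTheta := (Subgroup.inf_relIndex_right _ _).symm
    _ = X.barKer.relIndex X.barTheta := by rw [hE.inf_eq]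
    _ = l := X.relIndex_barKer

/-- `Ker(Δ_X ↠ Δ̄_X) ∩ E` is normal in `E` (indeed `Ker` is normal in `Π_C`); recorded so that the quotient
`E / Ker` of `isCyclic_eigen_quot` is a group (`haveI := X.normal_barKer_subgroupOf E`).
[cite: MochizukiEtTh2009, Prop 2.2(ii) p.37] -/
theorem normal_barKer_subgroupOf (E : Subgroup X.PiC) : (X.barKer.subgroupOf E).Normal := by
  haveI := X.barKer_normal
  infer_instance

/-- **Prop 2.2 (ii): "`Δ_X̲̲` [is a CYCLIC group of order `l`]"** for PRIME `l` (the regime of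
[IUTchI] Def. 3.1 (c)): `E / Ker(Δ_X ↠ Δ̄_X)` has prime order `l`, hence is cyclic (the instance
argument is `X.normal_barKer_subgroupOf E`). [cite: MochizukiEtTh2009, Prop 2.2(ii) p.37] -/
theorem isCyclic_eigen_quot [hp : Fact l.Prime] {H H' E : Subgroup X.PiC} {ι : X.PiC}
    [(X.barKer.subgroupOf E).Normal]
    (hH' : X.IsTypeLTorsPm H') (hH : H = H' ⊓ X.PiX) (hE : X.IsMinusEigen H H' ι E) :
    IsCyclic (↥E ⧸ X.barKer.subgroupOf E) :=
  isCyclic_of_prime_card (p := l) (X.relIndex_barKer_eigen hH' hH hE)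

end CoverData

end ThetaCovers

end Literature.AnabelianGeometry.EtaleTheta
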